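import Summits.BirchSwinnertonDyer.BirchSwinnertonDyer.Theorems.PrintX11aLowerHalfThreePartner
import Summits.BirchSwinnertonDyer.BirchSwinnertonDyer.Theorems.PrintX11aUpperNonSurjThreeCorollary18OfMazur
import Literature.NumberTheory.EllipticCurves.Kato2004.IwasawaCohomologyExistsProofs
import Literature.NumberTheory.EllipticCurves.Fisher2012.HesseFamilyThreeCongruenceProofs
import Literature.NumberTheory.EllipticCurves.BSDSelmerSmithCasesProofs
import HarnessLib

/-!
# Crux `X11aLowerHalf` (item stmt-BirchSwinnertonDyer-19064) at `p = 3` — the partner road with the partner taken FROM THE HESSE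
# PENCIL (Fisher 2012 Thm. 13.2, `n = 3`, PROVED in the tree): the `Γ_ℚ`-isomorphism `E[3] ≃ A[3]` needs no certificate
# (`--supports stmt-BirchSwinnertonDyer-19064` helper; seat bsd-line-er5-p2 = -w3 width seat of the 19064 line)

HONEST FRAMING. Theorems only; no definition, no named fact, no `sorry`; NO route file imported. CONDITIONAL on displayed named
facts and on displayed per-pair data; nothing closes the crux or a stub. BSD is proved for no curve. beyond-print theorem: no.

## What

The partner road (`PrintX11aLowerHalfThreePartner.lean`, p627615) takes a good-ordinary `3`-congruent partner `A` with a DISPLAYED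
`Γ_ℚ`-equivariant isomorphism `E[3] ≃ A[3]` (or a Kraus–Oesterlé congruence list). By Anema–Top–Tuijp (SIGMA 14 (2018) Thm. 1.1) ∕
Fisher (Proc. LMS 104 (2012) Thm. 13.2) every such partner is a member of the HESSE PENCIL of `E`, and the tree PROVES the congruence
for pencil members: `Fisher2012.thm132_threeCongruent_hessePencil_holds` ∕ `threeCongruent_hessePencil3` — for every elliptic `W/ℚ`
and every non-singular member `hessePencil3 W.c₄ W.c₆ l m` (`y² = x³ − 27𝔠₄(l,m)x − 54𝔠₆(l,m)`), `E_{l,m}[3] ≃ W[3]` `Γ_ℚ`-equivariantly.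
So the per-pair certificate SHRINKS to: two rationals `(l, m)`, a change of variables `C` to a global minimal model
`A = C • E_{l,m}`, and the finite checks «`A` good at `3`, `3 ∤ a₃(A)`» — no congruence list, no isomorphism datum.
* §1 `exists_torsionIso_hessePartner` — `W[3] ≃ (C • E_{l,m})[3]`, `Γ_ℚ`-equivariantly (Fisher + change of variables; PROVED, fact-free).
* §2 `ClassX11a.missingLowerBoundAt_three_of_hessePartner_of_facts` (r4∕r5 fact currency) and
  `ClassX11a.missingLowerBoundAt_three_of_hessePartner_of_contraFacts` (r6 print-exact currency) — THE LOWER HALF at an X11a pair with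
  `p = 3` from a Hesse-pencil partner good ordinary at `3` + named facts.
* §3 `partnerThree_of_hessePartnerThree` — the class-level statement «every finite-flat off-Kodaira deep X11a pair at 3 has a
  good-ordinary Hesse-pencil member» implies the registered-shape `hpartner` of `ThreePartner.lowerThreeDeep_…` (so the lead may register
  either shape). Census (this seat, `pub/bsd-stepL/line-er5-p2/g4/ff_hesse_partners.tsv`, Anema–Top–Tuijp's `(a_t, b_t)` normalisation):
  67 of the 71 finite-flat off-Kodaira deep classes with `N < 5·10⁵` have a good-ordinary pencil member of small height (`t = 9`, `±9/2`
  typical), the other four have a congruent Cremona curve of conductor `< 5·10⁵`.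

References: [Fisher2012Hessian] Thm. 13.2 (n = 3), §8; [AnemaTopTuijp2018] Thm. 1.1, Prop. 5.1 (SIGMA 14 (2018) 102); [EmertonPollackWeston2006]
Thm. 1, Cor. 5.1.4; [YanZhu2024MainConjNonCM] Thm. 4.9; [SilvermanAEC2009] III §1 (change of variables); [Miller2011LMS] Def. 1.1.
-/

set_option autoImplicit false
set_option linter.dupNamespace false -- the directory name repeats the summit name (sibling precedent)

noncomputable section

open scoped Classical MatrixGroups ModularForm

open CongruenceSubgroup UpperHalfPlane WeierstrassCurve IsDedekindDomain Rat.HeightOneSpectrum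
  Literature.NumberTheory.EllipticCurves
  Literature.NumberTheory.EllipticCurves.ModularForms
  Literature.NumberTheory.EllipticCurves.Rank1Residual
  Literature.NumberTheory.EllipticCurves.Rank1Residual.Typed
  Literature.NumberTheory.EllipticCurves.Wuthrich2014
  Literature.NumberTheory.EllipticCurves.SteinWuthrich2013
  Literature.NumberTheory.EllipticCurves.Greenberg1999
  Literature.NumberTheory.EllipticCurves.Kato2004
  Literature.NumberTheory.EllipticCurves.GreenbergVatsal2000
  Literature.NumberTheory.EllipticCurves.EmertonPollackWeston2006
  Literature.NumberTheory.EllipticCurves.Fisher2012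
  Literature.NumberTheory.GaloisRepresentations
  Summit.BirchSwinnertonDyer.Rank1Residual
  Summit.BirchSwinnertonDyer.Rank1Residual.X11a

namespace Summit.BirchSwinnertonDyer.BirchSwinnertonDyer.Theorems.ThreePartner

/-! ### §1 The `Γ_ℚ`-isomorphism for a Hesse-pencil partner (proved, fact-free) -/

/-- **`W[3] ≃ (C • E_{l,m})[3]`, `Γ_ℚ`-equivariantly**, for every elliptic `W/ℚ`, every non-singular member
`E_{l,m} = hessePencil3 W.c₄ W.c₆ l m` of the `n = 3` Hesse pencil of its `c₄,c₆`-model and every change of variables `C`: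
Fisher's Theorem 13.2 (`n = 3`; the tree's PROVED `thm132_threeCongruent_hessePencil_holds`, transported to `W` by
`threeCongruent_hessePencil3`) composed with the change-of-model isomorphism (`exists_geomTorsion_addEquiv_smul`).
[cite: Fisher2012Hessian, Thm. 13.2 (n = 3)] [cite: SilvermanAEC2009, III §1] -/
theorem exists_torsionIso_hessePartner (W : WeierstrassCurve ℚ) [W.IsElliptic] (l m : ℚ)
    [(hessePencil3 W.c₄ W.c₆ l m).IsElliptic] (C : VariableChange ℚ) :
    ∃ e : geomTorsion W (3 : ℤ) ≃+ geomTorsion (C • hessePencil3 W.c₄ W.c₆ l m) (3 : ℤ),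
      ∀ (σ : Field.absoluteGaloisGroup ℚ) (P : geomTorsion W (3 : ℤ)), e (σ • P) = σ • e P := by
  obtain ⟨e₁, he₁⟩ := threeCongruent_hessePencil3 thm132_threeCongruent_hessePencil_holds W l m
  obtain ⟨e₂, he₂⟩ := (hessePencil3 W.c₄ W.c₆ l m).exists_geomTorsion_addEquiv_smul C (3 : ℤ)
  refine ⟨e₁.symm.trans e₂, fun σ P => ?_⟩
  simp only [AddEquiv.trans_apply]
  rw [torsionIso_symm_smul e₁ he₁, he₂]

/-! ### §2 THE LOWER HALF at an X11a pair with `p = 3` from a Hesse-pencil partner good ordinary at `3` -/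

section Doors

variable {W : WeierstrassCurve ℚ} [W.IsElliptic] [W.IsGloballyMinimal] {p : ℕ} [Fact p.Prime]

/-- **The lower half at an X11a pair with `p = 3` from a HESSE-PENCIL partner** (r4∕r5 fact currency): data = two rationals `(l, m)`
with `E_{l,m}` non-singular, a change of variables `C` with `A := C • E_{l,m}` a global minimal model, and the finite checks «`A` has
good reduction at `3`» (`hgoodA`) and «`3 ∤ a₃(A)`» (`hordA`); the `Γ_ℚ`-isomorphism `E[3] ≃ A[3]` is §1 (PROVED). Facts as in
`ClassX11a.missingLowerBoundAt_three_of_partner_of_facts` (p627615). PER PAIR; CONDITIONAL; closes nothing class-wide.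
[cite: Fisher2012Hessian, Thm. 13.2 (n = 3)] [cite: EmertonPollackWeston2006, Thm. 1, Cor. 5.1.4] [cite: YanZhu2024MainConjNonCM, Thm. 4.9]
[cite: Miller2011LMS, Def. 1.1] -/
theorem _root_.Summit.BirchSwinnertonDyer.Rank1Residual.ClassX11a.missingLowerBoundAt_three_of_hessePartner_of_facts
    (hNf : exists_isNewformOf) (hEPW : cor514_transfer_of_goodOrdinary_odd)
    (hYZ : YanZhu2026.thm49_charIdeal_eq_padicLFunction) (h3 : realPeriodRat_eq_unit_mul_plusPeriod_three)
    (hTa : thm1_muAlg_transfer_goodOrdinary_of_mult_odd) (hTn : thm1_muAn_transfer_goodOrdinary_of_mult_odd)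
    (hMz : mazur_not_dvd_maninConstant_of_odd)
    (hKato : kato_charIdeal_dvd_multiplicative_of_surjective) (h20 : lemma20_surjective_threeAdic_of_semistable)
    (h12 : Kato2004.thm12_4) (hns : Kato2004.exists_multDivisibilityInputs_nonsplit)
    (hsp : Kato2004.exists_multDivisibilityInputs_split) (h15 : thm15_isTorsion_multiplicative_rat)
    (h18 : Wuthrich2014.corollary18_padicLFunction_mem_iwasawaAlgebra_multiplicative)
    (hfine : Kato2004.exists_multDivisibilityInputs_fine)
    (hJs : thm61_splitMultiplicative) (hJn : thm61_nonsplitMultiplicative)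
    (hGZK : rank_eq_analyticRank_of_analyticRank_le_one) (hGS : greenberg_stevens (W := W) (p := p))
    (hX : ClassX11a W p) (hp3 : p = 3) (l m : ℚ) [(hessePencil3 W.c₄ W.c₆ l m).IsElliptic] (C : VariableChange ℚ)
    [(C • hessePencil3 W.c₄ W.c₆ l m).IsElliptic] [(C • hessePencil3 W.c₄ W.c₆ l m).IsGloballyMinimal]
    (hgoodA : (C • hessePencil3 W.c₄ W.c₆ l m).HasGoodReductionAtPrime p)
    (hordA : ¬ (p : ℤ) ∣ (C • hessePencil3 W.c₄ W.c₆ l m).frobeniusTrace p) :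
    MissingLowerBoundAt W p := by
  have hiso : ∃ e : geomTorsion W (p : ℤ) ≃+ geomTorsion (C • hessePencil3 W.c₄ W.c₆ l m) (p : ℤ),
      ∀ (σ : Field.absoluteGaloisGroup ℚ) (P : geomTorsion W (p : ℤ)), e (σ • P) = σ • e P := by
    subst hp3
    exact exists_torsionIso_hessePartner W l m C
  exact hX.missingLowerBoundAt_three_of_partner_of_facts (C • hessePencil3 W.c₄ W.c₆ l m) hNf hEPW hYZ h3 hTa hTn hMz hKato h20
    h12 hns hsp h15 h18 hfine hJs hJn hGZK hGS hp3 hgoodA hordA hiso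

/-- **The lower half at an X11a pair with `p = 3` from a HESSE-PENCIL partner, PRINT-EXACT currency** (the line's r6: Kato §17.13
`_contra`, Mazur 4.1 for Cor. 18 ∕ Greenberg 1.5; the non-surjective divisibility by x11a-p2 g3's
`X11b.multDivisibilityAt_of_katoFacts_of_muAnZeroAt_contra_of_mazur`). Data and isomorphism as in the sibling. PER PAIR; CONDITIONAL.
[cite: Fisher2012Hessian, Thm. 13.2 (n = 3)] [cite: Kato2004Asterisque, Thm. 12.4 (p. 221), §17.13 (pp. 279–280)]
[cite: EmertonPollackWeston2006, Thm. 1, Cor. 5.1.4] [cite: YanZhu2024MainConjNonCM, Thm. 4.9] [cite: Miller2011LMS, Def. 1.1] -/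
theorem _root_.Summit.BirchSwinnertonDyer.Rank1Residual.ClassX11a.missingLowerBoundAt_three_of_hessePartner_of_contraFacts
    (hNf : exists_isNewformOf) (hEPW : cor514_transfer_of_goodOrdinary_odd)
    (hYZ : YanZhu2026.thm49_charIdeal_eq_padicLFunction) (h3 : realPeriodRat_eq_unit_mul_plusPeriod_three)
    (hTa : thm1_muAlg_transfer_goodOrdinary_of_mult_odd) (hTn : thm1_muAn_transfer_goodOrdinary_of_mult_odd)
    (hMz : mazur_not_dvd_maninConstant_of_odd)
    (hKato : kato_charIdeal_dvd_multiplicative_of_surjective) (h20 : lemma20_surjective_threeAdic_of_semistable)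
    (h12 : Kato2004.thm12_4) (hns' : Kato2004.exists_multDivisibilityInputs_nonsplit_contra)
    (hsp' : Kato2004.exists_multDivisibilityInputs_split_contra)
    (hfine' : Kato2004.exists_multDivisibilityInputs_fine_contra)
    (hJs : thm61_splitMultiplicative) (hJn : thm61_nonsplitMultiplicative)
    (hGZK : rank_eq_analyticRank_of_analyticRank_le_one) (hGS : greenberg_stevens (W := W) (p := p))
    (hX : ClassX11a W p) (hp3 : p = 3) (l m : ℚ) [(hessePencil3 W.c₄ W.c₆ l m).IsElliptic] (C : VariableChange ℚ)
    [(C • hessePencil3 W.c₄ W.c₆ l m).IsElliptic] [(C • hessePencil3 W.c₄ W.c₆ l m).IsGloballyMinimal]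
    (hgoodA : (C • hessePencil3 W.c₄ W.c₆ l m).HasGoodReductionAtPrime p)
    (hordA : ¬ (p : ℤ) ∣ (C • hessePencil3 W.c₄ W.c₆ l m).frobeniusTrace p) :
    MissingLowerBoundAt W p := by
  have hiso : ∃ e : geomTorsion W (p : ℤ) ≃+ geomTorsion (C • hessePencil3 W.c₄ W.c₆ l m) (p : ℤ),
      ∀ (σ : Field.absoluteGaloisGroup ℚ) (P : geomTorsion W (p : ℤ)), e (σ • P) = σ • e P := by
    subst hp3
    exact exists_torsionIso_hessePartner W l m C
  by_cases hsurj : Surj W p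
  · exact hX.missingLowerBoundAt_three_of_partner_of_surj (C • hessePencil3 W.c₄ W.c₆ l m) hNf hEPW hYZ h3 hTa hTn hMz hKato h20
      hJs hJn hGZK hGS hp3 hsurj hgoodA hordA hiso
  · have hμ : X11a.MuAnZeroAt W p := by
      subst hp3
      exact MultThreeMuAn.muAnZeroAt_three_of_mult_of_irr hMz W hX.mult hX.irr
    exact hX.missingLowerBoundAt_three_of_partner_of_multDivisibilityAt (C • hessePencil3 W.c₄ W.c₆ l m) hNf hEPW hYZ h3 hTa hTn
      hMz hJs hJn hGZK hGS hp3
      (X11b.multDivisibilityAt_of_katoFacts_of_muAnZeroAt_contra_of_mazur Kato2004.nonempty_iwasawaH1Data_holds h12 hNf hns' hsp'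
        hfine' hMz W p hX.ne_two hX.mult hX.irr hsurj hμ)
      hgoodA hordA hiso

end Doors

/-! ### §3 The Hesse-shaped class-level statement implies the registered partner shape -/

/-- **«Every finite-flat off-Kodaira deep X11a pair at 3 has a good-ordinary HESSE-PENCIL member» ⟹ the partner statement
`hpartner` of `ThreePartner.lowerThreeDeep_of_kodaira_of_partner_of_tresRamifie_of_(contra)facts`** (§1 supplies the isomorphism).
Either shape may be registered as the line's `p = 3` finite-flat stub. Pure logic + §1. [cite: Fisher2012Hessian, Thm. 13.2 (n = 3)]
[cite: AnemaTopTuijp2018, Thm. 1.1 (the pencil is universal; reading only)] -/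
theorem partnerThree_of_hessePartnerThree
    (hH : ∀ (W : WeierstrassCurve ℚ) [W.IsElliptic] [W.IsGloballyMinimal] (p : ℕ) [Fact p.Prime],
      ClassX11a W p → p = 3 → ¬ X11a.ShaAnUnit W p →
      ¬ (Surj W p ∧ ∃ v : HeightOneSpectrum ℤ, W.HasAdditiveReductionAt v ∧
          3 ∣ (W.kodairaSymbolAt v).componentGroupOrder ∧ ¬ natGenerator v ^ 3 ∣ W.conductorNorm ℤ) →
      p ∣ padicValInt p W.minimalDiscriminantInt →
      ∃ (l m : ℚ) (_ : (hessePencil3 W.c₄ W.c₆ l m).IsElliptic) (C : VariableChange ℚ)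
        (_ : (C • hessePencil3 W.c₄ W.c₆ l m).IsElliptic) (_ : (C • hessePencil3 W.c₄ W.c₆ l m).IsGloballyMinimal),
        (C • hessePencil3 W.c₄ W.c₆ l m).HasGoodReductionAtPrime p ∧
        ¬ (p : ℤ) ∣ (C • hessePencil3 W.c₄ W.c₆ l m).frobeniusTrace p) :
    ∀ (W : WeierstrassCurve ℚ) [W.IsElliptic] [W.IsGloballyMinimal] (p : ℕ) [Fact p.Prime],
      ClassX11a W p → p = 3 → ¬ X11a.ShaAnUnit W p →
      ¬ (Surj W p ∧ ∃ v : HeightOneSpectrum ℤ, W.HasAdditiveReductionAt v ∧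
          3 ∣ (W.kodairaSymbolAt v).componentGroupOrder ∧ ¬ natGenerator v ^ 3 ∣ W.conductorNorm ℤ) →
      p ∣ padicValInt p W.minimalDiscriminantInt →
      ∃ (A : WeierstrassCurve ℚ) (_ : A.IsElliptic) (_ : A.IsGloballyMinimal),
        A.HasGoodReductionAtPrime p ∧ ¬ (p : ℤ) ∣ A.frobeniusTrace p ∧
        ∃ e : geomTorsion W (p : ℤ) ≃+ geomTorsion A (p : ℤ),
          ∀ (σ : Field.absoluteGaloisGroup ℚ) (P : geomTorsion W (p : ℤ)), e (σ • P) = σ • e P := by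
  intro W _ _ p _ hX hp3 hu hK hff
  obtain ⟨l, m, hE, C, hA, hAm, hgood, hord⟩ := hH W p hX hp3 hu hK hff
  refine ⟨C • hessePencil3 W.c₄ W.c₆ l m, hA, hAm, hgood, hord, ?_⟩
  subst hp3
  exact exists_torsionIso_hessePartner W l m C

end Summit.BirchSwinnertonDyer.BirchSwinnertonDyer.Theorems.ThreePartner

end
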